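import Summits.QuantumFields.QCD.Theses.PauliWegnerSea
import Summits.QuantumFields.QCD.Theses.WilsonMobilityGap
import Literature.MathematicalPhysics.QuantumFieldTheory.QCDPhaseQuenched

/-!
# Disproof of `ChiralGluonicCompletion` — findings (cdisprove gen 1 / cycle 1, rev 4; rc 0, 0 sorry, std axioms)

Crux `stmt-QuantumFields-17498`, decl `Summit.QuantumFields.QCD.Theses.PauliWegnerSea.ChiralGluonicCompletion`
(= `…WilsonMobilityGap.ChiralGluonicCompletion`, `eq_wilsonMobilityGap`): the sibling `GluonicCompletion`
(stmt-9152) with the PIN `reg.IsChiralAtZero` inserted into the hypothesis. Self-contained: imports only the two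
route files and `QCDPhaseQuenched` (NOT the sibling's `Negative/{Threshold,Flanks}` — see STALE-OLEAN HAZARD).

## VERDICT: resists (no kill possible short of `¬QCD`) — and WHY, Lean-certified
* `chiralGluonicCompletion_iff` (`Iff.rfl`): crux = `∀ N_f ∈ {2,3}, HypC N_f → QCDOf N_f`, `HypC = ∃ reg, HypBody reg`,
  `HypBody = HasMassScaling ∧ IsChiralAtZero ∧ HasAsymptoticScaling ∧ ∀ m > 0, ((i)∧(ii)∧(iii)∧(iv)) ∧ PQFD`.
* `of_QCD`, `not_QCD_of_not`, `not_iff`: `¬crux ↔ (HypC 2 ∧ ¬QCDOf 2) ∨ (HypC 3 ∧ ¬QCDOf 3)`. A refutation needs a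
  CHIRAL mobility-gap construction (cruxes #2–#6, open) AND a disproof of the summit conjunct. `iff_QCD_of_hypC`.
* `of_gluonicCompletion` (9152 → 17498), `withoutPin_iff_gluonicCompletion` (`Iff.rfl`): dropping the pin is EXACTLY
  the sibling, so its load-bearing analysis of (i)–(iv)/PQFD/scaling (every weakening implied by `QCD`; junk regs
  killed by (iii) LOWER, `HasMassScaling`, `HasAsymptoticScaling`) transfers verbatim; `without_of_QCD`,
  `not_QCD_of_not_without`, `not_without_pin_iff`.
* WHAT THE PIN CHANGES (§2): dropping the per-mass package no longer collapses to `QCD` by a junk witness —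
  `withoutPerMassAndPin_iff_QCD` (collapse, witness `canonicalAF`) versus `withoutPerMass_iff` (`Iff.rfl`: the residual
  hypothesis `ChiralAFReg` asks for a chiral AF regularisation, as hard as crux #5's new conjunct;
  `chiralAFReg_of_qcdOf`, `chiralAFReg_imp_iff`). No junk regularisation is chiral at zero: the pin is a volume-uniform
  LOWER bound (or a blow-up, §5) on a signed connected correlator, and the tree bounds no lattice-QCD correlator below.

## COMPLETION MODES against the pin (§3) — the crux text's "may choose z, shift, keep reg, or subsequence"
* shift UP by `M₀`: `isChiralAtZero_mcritShift_iff` — chiral at zero iff the ORIGINAL reg is `ChiralAbove M₀`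
  (gapless points at all-components-`> M₀` masses); `not_chiralAbove_of_uniformGap` /
  `not_isChiralAtZero_mcritShift_of_uniformGap`: dead under any uniform gap above `M₀` (expected for honest
  trajectories, unprovable here). shift DOWN: `scheme_mcritShift_neg` — leaves the package's domain.
* `qcdOf_iff_chiralThreshold`: the CORRECTED threshold reading of the re-typed `QCDOf` (offset `M₀` + `ChiralAbove M₀`);
  the heavy-threshold graft `ThresholdQCD → GluonicCompletion → crux` is dead as typed (no chirality in stmt-8794).
* keep reg: `qcdOf_of_sameReg` — residual list (a) full-sequence convergence of all signed n-point functions,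
  (b) non-triviality ×3, (c) `T.HasMassGap`, (d) signed `HasLatticeMassGap` on ALL `S ≥ L_k`; ideators' G2/(A): (a) fails
  for interleaved witnesses; §5: (d) fails at any blow-up point (`no_sameReg_latticeGap_of_blowsUpAt`).
* subsequence: `hypBody_without_pin_subseq` (everything but the pin is hereditary), `isChiralAtZero_subseq_iff`
  (the pin along `φ` = violations of `reg` frequently ALONG `φ` — not selectable from `∃ᶠ` data; cf.
  `Sketch.frequently_not_subseq_stable`, `Ideator2.chiral_selection` needs STRONG chirality).

## FLANKS after the re-type (§4): `not_qcdOf_zero` (NEW: `QCDOf 0` is FALSE — pin vs gap clause at the vacuous tuple),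
`perMass_zero`, `hypC_zero_iff`, `at_zero_iff` (the `N_f = 0` extension of the crux is "every AF pure-SU(3) sequential
Wilson scheme has a uniform lattice gap at some rate" — lattice-YM-hard, believed TRUE: not a counterexample),
`nondecoupling_vacuous_one`.

## PIN SHAPE (§5): `hasLatticeMassGap_anti`, `isChiralAtZero_of_small`, `isChiralAtZero_of_gaplessPoint` (ONE gapless
tuple anywhere — heavy, split — gives the pin), `BlowsUpAt` / `not_hasLatticeMassGap_of_blowsUpAt` /
`isChiralAtZero_of_blowsUpAt` (chirality BY BLOW-UP of signed correlators: a sign pathology of the `(−1)^F`-twisted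
functional on tori `S > L_k`, where (iv) says nothing), `no_sameReg_latticeGap_of_blowsUpAt`,
`bounded_of_hasLatticeMassGap`, `hasLatticeMassGap_scheme_irrel`, `gapRate_lt_of_pin`, `isChiralAtZero_of_uniform`,
`qcdOf_witness_noBlowup` / `qcdOf_witness_gapped` (inside `QCDOf` the blow-up route is closed: the asymmetry is on the
hypothesis side only).
PLANNER NOTE (not a refutation — the looser pin makes the HYPOTHESIS weaker, the crux harder): as typed the pin
certifies "gapless OR sign-singular at some positive tuple"; the Goldstone reading would add volume-uniform
boundedness of signed correlators or ask the eventual lower-bound form (`Sketch.StronglyChiralSubseq`).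

## UP-SHIFT INVARIANCE (§6): `perMass_mcritShift_iff`, `hypGBody_mcritShift` (everything in `HypC` but the pin is
invariant under `m_crit ↦ m_crit + a_k M₀/Z_m`, `M₀ ≥ 0`), `hypBody_mcritShift_iff` (the up-shift of a witness is a
witness iff the original is `ChiralAbove M₀`), `packageForcesChirality_iff` / `not_packageForcesChirality_of` (the
route text's warning certified: "package ⇒ chiral" as a `∀ reg` item ≡ chirality above EVERY offset, refuted by any
package-carrying reg uniformly gapped above some threshold — so the pin must ride inside `∃ reg`, as filed).

## LANDED (importable, namespace `Summit.QuantumFields.QCD.Theorems.ChiralGluonicCompletion.Negative`):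
* `…/Theorems/ChiralGluonicCompletion/Negative/ChiralThreshold.lean` (p133557, commit 06bb976f):
  `qcdOf_iff_chiralThreshold`, `chiralAbove_mono`, `isChiralAtZero_of_chiralAbove`.
* `…/Negative/PinShape.lean` (p133582, commit 0a6eebe4): `isChiralAtZero_of_gaplessPoint`, `bounded_of_hasLatticeMassGap`,
  `not_hasLatticeMassGap_of_blowup`, `isChiralAtZero_of_blowup`, `no_sameReg_latticeGap_of_blowup`, `isChiralAtZero_of_uniform`.
* `…/Negative/Flanks.lean` (p133597, commit d6f006fd): `hypothesisPackage_zero`, `cruxAtZero_iff_latticeGap`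
  (reusing the landed `ChiralDescent.Negative.not_qcdOf_zero`).
* `…/Negative/UpShift.lean` (p133819, commit 7c30f6ed): `package_mcrit_shift_iff`, `hypothesisMinusPin_mcrit_shift`,
  `hypothesis_mcrit_shift_iff_chiralAbove` (§6, def-free, package text verbatim).
Related landed facts by other seats (reuse, do not restate): `RobustYangMillsHandover.Negative.{hasLatticeMassGap_species_irrel,
isChiralAtZero_mcrit_shift_iff, not_isChiralAtZero_mcrit_shift_of_uniformGapAbove, qcdOf_imp_aboveThreshold}`,
`ChiralDescent.Negative.{hasLatticeMassGap_mono, gap_lt_of_isChiralAtZero, not_qcdOf_zero}`.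

## STALE-OLEAN HAZARD (evidence `StaleOleanHazard.lean`, rc 0 std axioms): the farm serves pre-p117723 oleans of
`Theorems.GluonicCompletion.Negative.{Threshold,Flanks}` and `Theorems.PauliWegnerSeaGluonicCompletionOfThresholdQCD`;
their sources no longer elaborate, yet `Negative.qcdOf_iff_threshold`, `Negative.qcdOf_zero_iff`,
`gluonicCompletion_of_thresholdQCD` import — giving `ThresholdQCD → ChiralGluonicCompletion` (would close THIS crux
modulo stmt-8794 without chirality) and, with `not_qcdOf_zero`, the negation of the open pure-glue OS+gap statement.
PROVERS/LEAD: do not import those modules; use §3–§4 here (re-proved: `scheme_mcritShift`, `scaling_canonicalAF`).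

## BARRIERS (catalogue `Literature/Barriers/QuantumFields/`): `GoldstoneTheorem` (KRS: gap ⇒ no SSB) is what the pin
imports — consistent (gaplessness demanded only as `m → 0⁺`/at one tuple, gap at each fixed `m > 0`); `AokiPhase`
dichotomy: the pin is consistent with both branches (first-order branch: `m_π,min = O(a) → 0` along `a_k → 0`);
`BanksCasher` / `VafaWittenEigenvalueBound` (no volume-uniform Dirac gap as `m → 0⁺`): not entered — every constant
of the per-mass package is `m`-dependent; `WilsonDeterminantSign` / `…MassSplitting`: met at residual (a)/(d), as 9152.

## RESIDUAL = PROVER'S BURDEN: the sibling's (a)–(e) at the GIVEN critical line (no offset freedom), plus the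
chirality of the conclusion's witness: free if `reg` is kept (then (a) fails for interleaved hypothesis witnesses and
(d) needs signed boundedness on all `S ≥ L_k`), to be RE-PROVED (strong/eventual Goldstone lower bound, locally uniform
in the mass) if a subsequence is taken, impossible by up-shift under any uniform gap above the shift.
-/

noncomputable section

namespace Summit.QuantumFields.QCD.Cruxes.ChiralGluonicCompletion.Disproof

open scoped Topology SchwartzMap
open MeasureTheory Filter
open Literature.MathematicalPhysics.QuantumFieldTheory Literature.MathematicalPhysics.QuantumLattice
  Literature.Probability.LatticeModels Literature.MathematicalPhysics.AQFT
open Summit.QuantumFields.QCD.Theses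

variable {Nf : ℕ}

/-! ## §0 The crux, clause by clause (definitional packaging; `chiralGluonicCompletion_iff` is `Iff.rfl`).
Clause bodies are byte-copies of the route text (and of `Cruxes/GluonicCompletion/Disproof.lean` §0). -/

/-- Clause (i) (physical branch: bare masses eventually `> −1`). [folklore] -/
def ClauseI (reg : QCDRegularisation Nf) (m : Fin Nf → ℝ) : Prop :=
  ∀ f : Fin Nf, ∀ᶠ k in atTop, -1 < reg.mcrit k + reg.a k * m f / reg.Zm k

/-- Clause (ii) (UPPER: phase-quenched fractional-moment decay of the quark propagator at physical rate
`δ a_k`, uniformly on all tori of side `2S+1 ≥ 2L_k+1`). [folklore] -/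
def ClauseII (reg : QCDRegularisation Nf) (m : Fin Nf → ℝ) : Prop :=
  ∃ s δ C : ℝ, 0 < s ∧ s < 1 ∧ 0 < δ ∧ ∀ᶠ k in atTop, ∀ S : ℕ, reg.L k ≤ S → ∀ (f : Fin Nf) (v : Literature.Probability.LatticeModels.Site 4), v ∈ box 4 S → (∫ U : GaugeConfig 4 (2 * S + 1) (Matrix.specialUnitaryGroup (Fin 3) ℂ), ‖(diracMatrix U fun fl => reg.mcrit k + reg.a k * m fl / reg.Zm k).det‖ * (∑ a : Fin 3, ∑ i : Fin 4, ∑ b : Fin 3, ∑ j : Fin 4, ‖(diracMatrix U fun fl => reg.mcrit k + reg.a k * m fl / reg.Zm k)⁻¹ (quarkEquiv (f, (Torus.proj (2 * S + 1) 0, a, i))) (quarkEquiv (f, (Torus.proj (2 * S + 1) (v), b, j)))‖) ^ s ∂(wilsonMeasure (fundamentalRep (Fin 3)) (reg.β k))) / (∫ U : GaugeConfig 4 (2 * S + 1) (Matrix.specialUnitaryGroup (Fin 3) ℂ), ‖(diracMatrix U fun fl => reg.mcrit k + reg.a k * m fl / reg.Zm k).det‖ ∂(wilsonMeasure (fundamentalRep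 (Fin 3)) (reg.β k))) ≤ C * Real.exp (-(δ * (reg.a k * ‖v‖)))

/-- Clause (iii) (LOWER: the same moments along the time axis are not lattice-small). [folklore] -/
def ClauseIII (reg : QCDRegularisation Nf) (m : Fin Nf → ℝ) : Prop :=
  ∃ s c₀ C₁ p : ℝ, 0 < s ∧ s < 1 ∧ 0 < c₀ ∧ ∀ᶠ k in atTop, ∀ S : ℕ, reg.L k ≤ S → ∀ (f : Fin Nf) (n : ℕ), n ≤ S → c₀ * Real.exp (-(C₁ * (reg.a k * n) + p * Real.log (n + 1))) ≤ (∫ U : GaugeConfig 4 (2 * S + 1) (Matrix.specialUnitaryGroup (Fin 3) ℂ), ‖(diracMatrix U fun fl => reg.mcrit k + reg.a k * m fl / reg.Zm k).det‖ * (∑ a : Fin 3, ∑ i : Fin 4, ∑ b : Fin 3, ∑ j : Fin 4, ‖(diracMatrix U fun fl => reg.mcrit k + reg.a k * m fl / reg.Zm k)⁻¹ (quarkEquiv (f, (Torus.proj (2 * S + 1) 0, a, i))) (quarkEquiv (f, (Torus.proj (2 * S + 1) (Pi.single 0 (n : ℤ)), b, j)))‖) ^ s ∂(wilsonMeasure (fundamentalRep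 (Fin 3)) (reg.β k))) / (∫ U : GaugeConfig 4 (2 * S + 1) (Matrix.specialUnitaryGroup (Fin 3) ℂ), ‖(diracMatrix U fun fl => reg.mcrit k + reg.a k * m fl / reg.Zm k).det‖ ∂(wilsonMeasure (fundamentalRep (Fin 3)) (reg.β k)))

/-- Clause (iv) (SIGN coherence at the scheme's own side `2L_k+1`). [folklore] -/
def ClauseIV (reg : QCDRegularisation Nf) (m : Fin Nf → ℝ) : Prop :=
  ∀ᶠ k in atTop, (1 / 2 : ℝ) ≤ ‖∫ U : GaugeConfig 4 (2 * reg.L k + 1) (Matrix.specialUnitaryGroup (Fin 3) ℂ), (diracMatrix U fun fl => reg.mcrit k + reg.a k * m fl / reg.Zm k).det ∂(wilsonMeasure (fundamentalRep (Fin 3)) (reg.β k))‖ / (∫ U : GaugeConfig 4 (2 * reg.L k + 1) (Matrix.specialUnitaryGroup (Fin 3) ℂ), ‖(diracMatrix U fun fl => reg.mcrit k + reg.a k * m fl / reg.Zm k).det‖ ∂(wilsonMeasure (fundamentalRep (Fin 3)) (reg.β k)))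

/-- The conclusion of `PhaseQuenchedFlavourDecay` for `(reg, m)` (flavour-charged phase-quenched decay,
modulus OUTSIDE the gauge integral, as filed). [folklore] -/
def PQFD (reg : QCDRegularisation Nf) (m : Fin Nf → ℝ) : Prop :=
  ∃ δ' : ℝ, 0 < δ' ∧ ∀ (R R' : ℕ) (A : QCDLatticeObservable Nf R) (B : QCDLatticeObservable Nf R'), (∃ (f₀ : Fin Nf) (q : ℤ), q ≠ 0 ∧ ∀ (θ : ℝ) (U : LGConfig 4 (Matrix.specialUnitaryGroup (Fin 3) ℂ)), ExteriorAlgebra.map (LinearMap.pi fun w => (Sum.elim (fun i => if (boxQuarkEquiv.symm i).1 = f₀ then Complex.exp (-((θ : ℂ) * Complex.I)) else 1) (fun i => if (boxQuarkEquiv.symm i).1 = f₀ then Complex.exp ((θ : ℂ) * Complex.I) else 1) (ofLex w)) • LinearMap.proj w) (A.F U) = Complex.exp (((q : ℝ) * θ : ℝ) * Complex.I) • A.F U) → ∃ C' : ℝ, ∀ᶠ k in atTop, ∀ S : ℕ, reg.L k ≤ S → ∀ n : ℕ, n ≤ S → ‖(∫ U : GaugeConfig 4 (2 * S + 1) (Matrix.specialUnitaryGroup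 (Fin 3) ℂ), (‖(diracMatrix U fun fl => reg.mcrit k + reg.a k * m fl / reg.Zm k).det‖ : ℂ) * (fermiIntegral (A.onTorus (2 * S + 1) 0 U * B.onTorus (2 * S + 1) (Pi.single 0 (n : ℤ)) U * fermiBoltzmann U fun fl => reg.mcrit k + reg.a k * m fl / reg.Zm k) / fermiIntegral (fermiBoltzmann U fun fl => reg.mcrit k + reg.a k * m fl / reg.Zm k)) ∂(wilsonMeasure (fundamentalRep (Fin 3)) (reg.β k))) / (∫ U : GaugeConfig 4 (2 * S + 1) (Matrix.specialUnitaryGroup (Fin 3) ℂ), (‖(diracMatrix U fun fl => reg.mcrit k + reg.a k * m fl / reg.Zm k).det‖ : ℂ) ∂(wilsonMeasure (fundamentalRep (Fin 3)) (reg.β k)))‖ ≤ C' * Real.exp (-(δ' * (reg.a k * n)))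

/-- The per-mass package `((i) ∧ (ii) ∧ (iii) ∧ (iv)) ∧ PQFD` (the bracketting of the crux text). [folklore] -/
def PerMass (reg : QCDRegularisation Nf) (m : Fin Nf → ℝ) : Prop :=
  (ClauseI reg m ∧ ClauseII reg m ∧ ClauseIII reg m ∧ ClauseIV reg m) ∧ PQFD reg m

/-- The body of the hypothesis for ONE regularisation: scaling side conditions, the PIN, the package. [folklore] -/
def HypBody (reg : QCDRegularisation Nf) : Prop :=
  reg.HasMassScaling ∧ reg.IsChiralAtZero ∧ (reg.scheme 0 0 0).HasAsymptoticScaling ∧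
    ∀ m : Fin Nf → ℝ, (∀ f, 0 < m f) → PerMass reg m

variable (Nf) in
/-- **The hypothesis `HypC N_f` of the crux** (C for "chiral"): some mass-independent regularisation that is
CHIRAL AT ZERO, with the scaling side conditions, satisfies the per-mass package at every positive mass tuple. [folklore] -/
def HypC : Prop := ∃ reg : QCDRegularisation Nf, HypBody reg

variable (Nf) in
/-- The hypothesis of the pin-free sibling crux `GluonicCompletion` (stmt-QuantumFields-9152). [folklore] -/
def HypG : Prop :=
  ∃ reg : QCDRegularisation Nf, reg.HasMassScaling ∧ (reg.scheme 0 0 0).HasAsymptoticScaling ∧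
    ∀ m : Fin Nf → ℝ, (∀ f, 0 < m f) → PerMass reg m

variable (Nf) in
/-- The crux at one flavour number. [folklore] -/
def At : Prop := HypC Nf → QCDOf Nf

/-- **The crux is, definitionally, `∀ N_f ∈ {2,3}, HypC N_f → QCDOf N_f`.** [folklore] -/
theorem chiralGluonicCompletion_iff :
    PauliWegnerSea.ChiralGluonicCompletion ↔ ∀ Nf : ℕ, Nf = 2 ∨ Nf = 3 → At Nf := Iff.rfl

/-- The two route copies of the crux are the same term. [folklore] -/
theorem eq_wilsonMobilityGap :
    PauliWegnerSea.ChiralGluonicCompletion = WilsonMobilityGap.ChiralGluonicCompletion := rfl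

/-- The pin-free sibling is, definitionally, `∀ N_f ∈ {2,3}, HypG N_f → QCDOf N_f`. [folklore] -/
theorem gluonicCompletion_iff :
    PauliWegnerSea.GluonicCompletion ↔ ∀ Nf : ℕ, Nf = 2 ∨ Nf = 3 → HypG Nf → QCDOf Nf := Iff.rfl

/-- `HypC → HypG` (forget the pin). [folklore] -/
theorem hypG_of_hypC (h : HypC Nf) : HypG Nf := by
  obtain ⟨reg, hMS, -, hAS, hper⟩ := h
  exact ⟨reg, hMS, hAS, hper⟩

/-! ## §1 Structure: the crux is glue between the summit conjunct and its own hypothesis -/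

/-- `QCD` proves the crux outright (the conclusion never mentions the hypothesis' `reg`). [folklore] -/
theorem of_QCD (h : _root_.QCD) : PauliWegnerSea.ChiralGluonicCompletion := by
  rw [chiralGluonicCompletion_iff]
  rintro Nf (rfl | rfl) _
  exacts [h.1, h.2]

/-- Hence any disproof of the crux disproves the summit conjunct `QCD`. [folklore] -/
theorem not_QCD_of_not (h : ¬ PauliWegnerSea.ChiralGluonicCompletion) : ¬ _root_.QCD :=
  fun hq => h (of_QCD hq)

/-- **What a refutation must contain**: `¬ crux ↔ (HypC 2 ∧ ¬ QCDOf 2) ∨ (HypC 3 ∧ ¬ QCDOf 3)` — a CHIRAL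
mobility-gap-type construction AND a disproof of massive two- or three-flavour QCD. [folklore] -/
theorem not_iff : ¬ PauliWegnerSea.ChiralGluonicCompletion ↔ (HypC 2 ∧ ¬ QCDOf 2) ∨ (HypC 3 ∧ ¬ QCDOf 3) := by
  rw [chiralGluonicCompletion_iff]
  constructor
  · intro h
    by_contra hc
    push Not at hc
    exact h fun Nf hNf hH => by
      rcases hNf with rfl | rfl
      · exact hc.1 hH
      · exact hc.2 hH
  · rintro (⟨hH, hQ⟩ | ⟨hH, hQ⟩) h
    · exact hQ (h 2 (Or.inl rfl) hH)
    · exact hQ (h 3 (Or.inr rfl) hH)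

/-- If the hypothesis is available at both flavour numbers, the crux IS the summit conjunct. [folklore] -/
theorem iff_QCD_of_hypC (h2 : HypC 2) (h3 : HypC 3) : PauliWegnerSea.ChiralGluonicCompletion ↔ _root_.QCD :=
  ⟨fun h => ⟨(chiralGluonicCompletion_iff.1 h) 2 (Or.inl rfl) h2, (chiralGluonicCompletion_iff.1 h) 3 (Or.inr rfl) h3⟩,
    of_QCD⟩

/-- Vacuous case: if the chiral hypothesis fails at both flavour numbers the crux holds for lack of input
(then crux #5 `ChiralOneScaleTrajectory` / `ChiralMobilityGap` is false — the ROUTES die, not this item). [folklore] -/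
theorem of_not_hypC (h2 : ¬ HypC 2) (h3 : ¬ HypC 3) : PauliWegnerSea.ChiralGluonicCompletion := by
  rw [chiralGluonicCompletion_iff]
  rintro Nf (rfl | rfl) hH
  exacts [(h2 hH).elim, (h3 hH).elim]

/-- **The sibling implies the crux in one line** (stronger hypothesis here): `GluonicCompletion →
ChiralGluonicCompletion`. [folklore] -/
theorem of_gluonicCompletion (h : PauliWegnerSea.GluonicCompletion) : PauliWegnerSea.ChiralGluonicCompletion := by
  rw [chiralGluonicCompletion_iff]
  exact fun Nf hNf hH => (gluonicCompletion_iff.1 h) Nf hNf (hypG_of_hypC hH)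

/-- **Dropping the pin from the hypothesis gives back EXACTLY the sibling 9152** (`Iff.rfl`). So the pin is the
only new load-bearing hypothesis relative to `Cruxes/GluonicCompletion/Disproof.lean`, whose §2 load-bearing
analysis of (i)–(iv), PQFD and the scaling side conditions transfers verbatim (every weakening is still implied by
`QCD`, `without_of_QCD` below). [folklore] -/
theorem withoutPin_iff_gluonicCompletion :
    (∀ Nf : ℕ, Nf = 2 ∨ Nf = 3 → HypG Nf → QCDOf Nf) ↔ PauliWegnerSea.GluonicCompletion := Iff.rfl

/-! ## §2 Load-bearing analysis of the PIN `reg.IsChiralAtZero`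

No hypothesis can be dropped INTO FALSITY: every weakening of `HypC` keeps the crux implied by `QCD`
(`without_of_QCD`), so a `_false_without_pin` theorem would be `¬ GluonicCompletion`, i.e. `HypG ∧ ¬QCDOf`
(`not_without_pin_iff`). What the pin changes is WHICH weakenings collapse to the summit conjunct: -/

/-- The crux with the hypothesis body replaced by an arbitrary predicate `P` on regularisations. [folklore] -/
def Without (P : ∀ {Nf : ℕ}, QCDRegularisation Nf → Prop) : Prop :=
  ∀ Nf : ℕ, Nf = 2 ∨ Nf = 3 → (∃ reg : QCDRegularisation Nf, P reg) → QCDOf Nf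

/-- Every weakening (indeed every replacement) of the hypothesis is still implied by `QCD`. [folklore] -/
theorem without_of_QCD (P : ∀ {Nf : ℕ}, QCDRegularisation Nf → Prop) (h : _root_.QCD) : Without P := by
  rintro Nf (rfl | rfl) _
  exacts [h.1, h.2]

/-- … so refuting any weakened crux refutes `QCD`. [folklore] -/
theorem not_QCD_of_not_without (P : ∀ {Nf : ℕ}, QCDRegularisation Nf → Prop) (h : ¬ Without P) :
    ¬ _root_.QCD := fun hq => h (without_of_QCD P hq)

/-- The filed crux is `Without HypBody`. [folklore] -/
theorem without_hypBody_iff : Without (fun reg => HypBody reg) ↔ PauliWegnerSea.ChiralGluonicCompletion := Iff.rfl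

/-- `¬ (crux without the pin) ↔ (HypG 2 ∧ ¬QCDOf 2) ∨ (HypG 3 ∧ ¬QCDOf 3)` — the would-be
`_false_without_pin` theorem is a pin-free mobility-gap construction plus a disproof of `QCDOf`. [folklore] -/
theorem not_without_pin_iff :
    ¬ PauliWegnerSea.GluonicCompletion ↔ (HypG 2 ∧ ¬ QCDOf 2) ∨ (HypG 3 ∧ ¬ QCDOf 3) := by
  rw [gluonicCompletion_iff]
  constructor
  · intro h
    by_contra hc
    push Not at hc
    exact h fun Nf hNf hH => by
      rcases hNf with rfl | rfl
      · exact hc.1 hH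
      · exact hc.2 hH
  · rintro (⟨hH, hQ⟩ | ⟨hH, hQ⟩) h
    · exact hQ (h 2 (Or.inl rfl) hH)
    · exact hQ (h 3 (Or.inr rfl) hH)

/-- The scaling side conditions are inhabited by the tree's `canonicalAF` (re-proved here; the landed copy
`GluonicCompletion.Negative.scaling_canonicalAF` sits in a module whose olean is STALE, see the docblock). [folklore] -/
theorem scaling_canonicalAF (Nf : ℕ) :
    (QCDRegularisation.canonicalAF Nf).HasMassScaling ∧
      ((QCDRegularisation.canonicalAF Nf).scheme 0 0 0).HasAsymptoticScaling := by
  refine ⟨QCDRegularisation.canonicalAF_hasMassScaling, 1, one_pos, ?_⟩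
  refine tendsto_const_nhds.congr' (Eventually.of_forall fun k => ?_)
  simp [QCDRegularisation.scheme, QCDRegularisation.canonicalAF, QCDScheme.zeroAF]

/-- **Pin-free collapse (sibling, re-certified against the re-typed `QCDOf`): dropping the per-mass package AND the
pin turns the crux into `QCD` itself** — the residual hypothesis is inhabited by `canonicalAF`. [folklore] -/
theorem withoutPerMassAndPin_iff_QCD :
    Without (fun reg => reg.HasMassScaling ∧ (reg.scheme 0 0 0).HasAsymptoticScaling) ↔ _root_.QCD := by
  refine ⟨fun h => ⟨h 2 (Or.inl rfl) ⟨_, scaling_canonicalAF 2⟩, h 3 (Or.inr rfl) ⟨_, scaling_canonicalAF 3⟩⟩, ?_⟩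
  rintro ⟨h2, h3⟩ Nf (rfl | rfl) _
  exacts [h2, h3]

variable (Nf) in
/-- "Some chiral-at-zero regularisation with the scaling side conditions exists" — the residual hypothesis when the
per-mass package is dropped but the PIN is kept. NOT junk-inhabited: `IsChiralAtZero` asks for a volume-uniform
LOWER bound (or a blow-up, §5) on a signed connected lattice correlator frequently in `k`, which no declaration of
the tree provides for any regularisation. [folklore] -/
def ChiralAFReg : Prop :=
  ∃ reg : QCDRegularisation Nf, reg.HasMassScaling ∧ reg.IsChiralAtZero ∧ (reg.scheme 0 0 0).HasAsymptoticScaling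

/-- `QCDOf N_f` itself supplies such a regularisation (its witness is chiral, and `IsQCDAlong` carries the
asymptotic scaling of `reg.scheme m z shift`, whose `β`, `a` are `reg`'s). [folklore] -/
theorem chiralAFReg_of_qcdOf (h : QCDOf Nf) : ChiralAFReg Nf := by
  obtain ⟨reg, hMS, hch, hm⟩ := h
  obtain ⟨z, shift, T, ⟨hAS, -⟩, -⟩ := hm (fun _ => 1) (fun _ => one_pos)
  refine ⟨reg, hMS, hch, ?_⟩
  obtain ⟨Λ, hΛ, hT⟩ := hAS
  exact ⟨Λ, hΛ, hT⟩

/-- **With the pin, dropping the per-mass package NO LONGER collapses to `QCD` by a junk witness**: the weakened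
crux reads `ChiralAFReg N_f → QCDOf N_f` (`Iff.rfl`), whose hypothesis is exactly as hard to inhabit as a chiral
lattice trajectory (crux #5's new conjunct). It is still implied by `QCD` (`without_of_QCD`) and is equivalent to
`QCDOf N_f` as soon as ONE chiral AF regularisation exists. [folklore] -/
theorem withoutPerMass_iff :
    Without (fun reg => reg.HasMassScaling ∧ reg.IsChiralAtZero ∧ (reg.scheme 0 0 0).HasAsymptoticScaling) ↔
      ∀ Nf : ℕ, Nf = 2 ∨ Nf = 3 → ChiralAFReg Nf → QCDOf Nf := Iff.rfl

/-- … precisely: at each flavour number the weakened crux is `QCDOf N_f ∨ ¬ ChiralAFReg N_f`. [folklore] -/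
theorem chiralAFReg_imp_iff : (ChiralAFReg Nf → QCDOf Nf) ↔ (QCDOf Nf ∨ ¬ ChiralAFReg Nf) := by
  constructor
  · intro h
    by_cases hc : ChiralAFReg Nf
    · exact Or.inl (h hc)
    · exact Or.inr hc
  · rintro (h | h) hc
    · exact h
    · exact (h hc).elim


/-! ## §3 How a completion may choose its witness regularisation (the crux text: "may choose z, shift, keep
reg, or pass to a subsequence retaining the chiral witnesses, but may NO LONGER shift the flavour-blind
offset") — certified bookkeeping of each mode against the pin -/

/-- The regularisation with its critical mass shifted by the flavour-blind offset `a_k M₀ / Z_m(k)`. [folklore] -/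
def mcritShift (reg : QCDRegularisation Nf) (M₀ : ℝ) : QCDRegularisation Nf :=
  { reg with mcrit := fun k => reg.mcrit k + reg.a k * M₀ / reg.Zm k }

/-- Shifting `m_crit` by `a_k M₀ / Z_m(k)` and running at masses `m` is running `reg` at masses `M₀ + m`
(the landed `GluonicCompletion.Negative.scheme_mcrit_shift`, re-proved to avoid the stale module). [folklore] -/
theorem scheme_mcritShift (reg : QCDRegularisation Nf) (M₀ : ℝ) (m : Fin Nf → ℝ)
    (z shift : QCDField Nf → ℕ → ℝ) :
    (mcritShift reg M₀).scheme m z shift = reg.scheme (fun f => M₀ + m f) z shift := by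
  simp only [mcritShift, QCDRegularisation.scheme, QCDScheme.mk.injEq, true_and, and_true]
  funext f k
  ring

/-- The shift does not touch `Z_m`: mass scaling is invariant. [folklore] -/
theorem hasMassScaling_mcritShift_iff (reg : QCDRegularisation Nf) (M₀ : ℝ) :
    (mcritShift reg M₀).HasMassScaling ↔ reg.HasMassScaling := Iff.rfl

/-- The shift does not touch `β`, `a`: asymptotic scaling is invariant. [folklore] -/
theorem hasAsymptoticScaling_mcritShift_iff (reg : QCDRegularisation Nf) (M₀ : ℝ) (m : Fin Nf → ℝ)
    (z shift : QCDField Nf → ℕ → ℝ) :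
    ((mcritShift reg M₀).scheme m z shift).HasAsymptoticScaling ↔ (reg.scheme m z shift).HasAsymptoticScaling :=
  Iff.rfl

/-- **Chirality ABOVE the offset `M₀`**: for every rate `ε > 0` some mass tuple with ALL components `> M₀` has no
uniform lattice gap `ε` in the honest theory of `reg`. `ChiralAbove reg 0` is the pin (`Iff.rfl`). [folklore] -/
def ChiralAbove (reg : QCDRegularisation Nf) (M₀ : ℝ) : Prop :=
  ∀ ε > (0 : ℝ), ∃ m : Fin Nf → ℝ, (∀ f, M₀ < m f) ∧ ¬ (reg.scheme m 0 0).HasLatticeMassGap ε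

/-- The pin is chirality above the offset `0`. [folklore] -/
theorem chiralAbove_zero_iff (reg : QCDRegularisation Nf) : ChiralAbove reg 0 ↔ reg.IsChiralAtZero := Iff.rfl

/-- **The shifted regularisation is chiral at zero iff the original is chiral above the shift.** [folklore] -/
theorem isChiralAtZero_mcritShift_iff (reg : QCDRegularisation Nf) (M₀ : ℝ) :
    (mcritShift reg M₀).IsChiralAtZero ↔ ChiralAbove reg M₀ := by
  constructor
  · intro h ε hε
    obtain ⟨m, hm, hgap⟩ := h ε hε
    refine ⟨fun f => M₀ + m f, fun f => by linarith [hm f], ?_⟩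
    rwa [scheme_mcritShift] at hgap
  · intro h ε hε
    obtain ⟨m, hm, hgap⟩ := h ε hε
    refine ⟨fun f => m f - M₀, fun f => by linarith [hm f], ?_⟩
    have hm' : (fun f => M₀ + (m f - M₀)) = m := funext fun f => by ring
    rw [scheme_mcritShift, hm']
    exact hgap

/-- **An up-shifted completion needs gapless points of the ORIGINAL regularisation above the shift**: any
volume-uniform lattice gap of `reg` at one positive rate on the whole region `{m : ∀ f, M₀ < m_f}` forbids the
witness `mcritShift reg M₀`. (Physically expected for every `M₀ > 0` along an honest trajectory — pions are
massive above the chiral point — but no such gap is provable in the tree; this is the exact negative content of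
"may no longer shift the offset".) [folklore] -/
theorem not_chiralAbove_of_uniformGap (reg : QCDRegularisation Nf) (M₀ : ℝ)
    (h : ∃ ε > (0 : ℝ), ∀ m : Fin Nf → ℝ, (∀ f, M₀ < m f) → (reg.scheme m 0 0).HasLatticeMassGap ε) :
    ¬ ChiralAbove reg M₀ := by
  rintro hc
  obtain ⟨ε, hε, hgap⟩ := h
  obtain ⟨m, hm, hn⟩ := hc ε hε
  exact hn (hgap m hm)

/-- … hence the shifted witness is not chiral at zero under such a gap. [folklore] -/
theorem not_isChiralAtZero_mcritShift_of_uniformGap (reg : QCDRegularisation Nf) (M₀ : ℝ)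
    (h : ∃ ε > (0 : ℝ), ∀ m : Fin Nf → ℝ, (∀ f, M₀ < m f) → (reg.scheme m 0 0).HasLatticeMassGap ε) :
    ¬ (mcritShift reg M₀).IsChiralAtZero :=
  fun hc => not_chiralAbove_of_uniformGap reg M₀ h ((isChiralAtZero_mcritShift_iff reg M₀).1 hc)

/-- **The corrected threshold reading of the re-typed `QCDOf`** (replaces `GluonicCompletion.Negative.qcdOf_iff_threshold`,
whose `←` half is UNPROVABLE after p117723 and whose served olean is stale): it suffices to produce the `QCDOf`
body above a common offset `M₀ ≥ 0` TOGETHER WITH chirality above `M₀` — then shift `m_crit`. Without the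
`ChiralAbove` conjunct (the heavy-threshold statement `HeavyThresholdYMBridge.ThresholdQCD`, stmt-8794) nothing
follows any more: the graft `ThresholdQCD → GluonicCompletion → ChiralGluonicCompletion` is dead as typed. [folklore] -/
theorem qcdOf_iff_chiralThreshold (Nf : ℕ) : QCDOf Nf ↔ ∃ M₀ : ℝ, 0 ≤ M₀ ∧ ∃ reg : QCDRegularisation Nf,
    reg.HasMassScaling ∧ ChiralAbove reg M₀ ∧ ∀ m : Fin Nf → ℝ, (∀ f, M₀ < m f) →
      ∃ (z shift : QCDField Nf → ℕ → ℝ) (T : OSData (QCDField Nf) 4),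
        IsQCDAlong (reg.scheme m z shift) T ∧ T.IsNontrivial QCDField.glue ∧ T.IsNonGaussian QCDField.glue ∧
          (∀ f g : Fin Nf, f ≠ g → T.IsNontrivial (QCDField.pseudoRe f g)) ∧
            ∃ Δ > 0, T.HasMassGap Δ ∧ (reg.scheme m z shift).HasLatticeMassGap Δ := by
  constructor
  · rintro ⟨reg, hMS, hch, h⟩
    exact ⟨0, le_rfl, reg, hMS, hch, h⟩
  · rintro ⟨M₀, -, reg, hMS, hch, h⟩
    refine ⟨mcritShift reg M₀, hMS, (isChiralAtZero_mcritShift_iff reg M₀).2 hch, fun m hm => ?_⟩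
    obtain ⟨z, shift, T, hQ, hN, hG, hP, Δ, hΔ, hT, hL⟩ :=
      h (fun f => M₀ + m f) (fun f => by linarith [hm f])
    refine ⟨z, shift, T, ?_, hN, hG, hP, Δ, hΔ, hT, ?_⟩
    · rwa [scheme_mcritShift]
    · rwa [scheme_mcritShift]

/-- DOWN-shifts leave the package's domain: the per-mass package of `mcritShift reg (−M₀)` at `m` is `reg`'s
package at `m − M₀`, which the hypothesis supplies only for `m_f > M₀`. [folklore] -/
theorem scheme_mcritShift_neg (reg : QCDRegularisation Nf) (M₀ : ℝ) (m : Fin Nf → ℝ)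
    (z shift : QCDField Nf → ℕ → ℝ) :
    (mcritShift reg (-M₀)).scheme m z shift = reg.scheme (fun f => m f - M₀) z shift := by
  rw [scheme_mcritShift]
  congr 1
  funext f
  ring

/-- **Keep-`reg` completion: the residual list as one statement.** Keeping the hypothesis' own regularisation,
the pin and `HasMassScaling` travel by `rfl` and asymptotic scaling + clause (i) discharge the first two conjuncts
of `IsQCDAlong`; what remains at EVERY `m > 0` along the FULL sequence is (a) convergence of all honest (signed)
lattice `n`-point functions, (b) non-triviality ×3, (c) `T.HasMassGap Δ`, (d) the signed `HasLatticeMassGap Δ`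
on ALL tori `S ≥ L_k`. (Ideators' G2/(A): for interleaved hypothesis witnesses (a) FAILS — keep-`reg` is not a
line in general; §5 adds that (d) already fails whenever the pin is met by a blow-up point.) [folklore] -/
theorem qcdOf_of_sameReg (reg : QCDRegularisation Nf) (hB : HypBody reg)
    (h : ∀ m : Fin Nf → ℝ, (∀ f, 0 < m f) → ∃ (z shift : QCDField Nf → ℕ → ℝ) (T : OSData (QCDField Nf) 4),
      (∀ n : ℕ, n ≠ 0 → ∀ (σ : Fin n → QCDField Nf) (f : Fin n → 𝓢(EuclideanSpace ℝ (Fin 4), ℝ))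
          (F : 𝓢((Fin n → EuclideanSpace ℝ (Fin 4)), ℂ)), IsTensorOf F (fun i => ofRealTest (f i)) →
            IsOffDiagonal F →
              Tendsto (fun k : ℕ => qcdLatticeSchwinger (reg.scheme m z shift) k n σ f) atTop
                (𝓝 (T.schwinger n σ F))) ∧
        T.IsNontrivial QCDField.glue ∧ T.IsNonGaussian QCDField.glue ∧
          (∀ f g : Fin Nf, f ≠ g → T.IsNontrivial (QCDField.pseudoRe f g)) ∧
            ∃ Δ > 0, T.HasMassGap Δ ∧ (reg.scheme m z shift).HasLatticeMassGap Δ) :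
    QCDOf Nf := by
  obtain ⟨hMS, hch, hAS, hper⟩ := hB
  refine ⟨reg, hMS, hch, fun m hm => ?_⟩
  obtain ⟨z, shift, T, hconv, hN, hG, hP, hΔ⟩ := h m hm
  exact ⟨z, shift, T, ⟨hAS, (hper m hm).1.1, hconv⟩, hN, hG, hP, hΔ⟩

/-- The regularisation along a subsequence `φ`. [folklore] -/
def subseq (reg : QCDRegularisation Nf) (φ : ℕ → ℕ) (hφ : StrictMono φ) : QCDRegularisation Nf where
  a := fun k => reg.a (φ k)
  a_pos k := reg.a_pos (φ k)
  tendsto_a := reg.tendsto_a.comp hφ.tendsto_atTop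
  β := fun k => reg.β (φ k)
  L := fun k => reg.L (φ k)
  tendsto_L := reg.tendsto_L.comp hφ.tendsto_atTop
  mcrit := fun k => reg.mcrit (φ k)
  Zm := fun k => reg.Zm (φ k)
  Zm_pos k := reg.Zm_pos (φ k)

/-- **Everything in the hypothesis EXCEPT the pin is hereditary under subsequences** (all other clauses are
`∀ᶠ k` / `Tendsto` statements). [folklore] -/
theorem hypBody_without_pin_subseq (reg : QCDRegularisation Nf) (φ : ℕ → ℕ) (hφ : StrictMono φ)
    (hMS : reg.HasMassScaling) (hAS : (reg.scheme 0 0 0).HasAsymptoticScaling)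
    (hper : ∀ m : Fin Nf → ℝ, (∀ f, 0 < m f) → PerMass reg m) :
    (subseq reg φ hφ).HasMassScaling ∧ ((subseq reg φ hφ).scheme 0 0 0).HasAsymptoticScaling ∧
      ∀ m : Fin Nf → ℝ, (∀ f, 0 < m f) → PerMass (subseq reg φ hφ) m := by
  have hT := hφ.tendsto_atTop
  refine ⟨?_, ?_, fun m hm => ?_⟩
  · obtain ⟨c, hc, h⟩ := hMS
    exact ⟨c, hc, h.comp hT⟩
  · obtain ⟨Λ, hΛ, h⟩ := hAS
    exact ⟨Λ, hΛ, h.comp hT⟩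
  · obtain ⟨⟨h1, ⟨s, δ, C, hs, hs1, hδ, h2⟩, ⟨s', c₀, C₁, p, hs', hs1', hc₀, h3⟩, h4⟩, ⟨δ', hδ', h5⟩⟩ := hper m hm
    refine ⟨⟨fun f => hT.eventually (h1 f), ⟨s, δ, C, hs, hs1, hδ, hT.eventually h2⟩,
      ⟨s', c₀, C₁, p, hs', hs1', hc₀, hT.eventually h3⟩, hT.eventually h4⟩, ⟨δ', hδ', fun R R' A B hA => ?_⟩⟩
    obtain ⟨C', hC'⟩ := h5 R R' A B hA
    exact ⟨C', hT.eventually hC'⟩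

/-- **The pin along a subsequence, unfolded**: `reg ∘ φ` is chiral at zero iff for every rate some positive mass
tuple and some pair `(A, B)` violate the gap inequality of `reg` at indices `φ t` for INFINITELY MANY `t` (for every
constant). This is all a "diagonal choice retaining the chiral witnesses" may use — and a `∃ᶠ` property of `reg` need
not hold frequently along `φ` (ideators' G1/G3; `Sketch.frequently_not_subseq_stable`): a subsequencing completion
must RE-PROVE chirality (strong / eventual Goldstone form), it cannot select it. [folklore] -/
theorem isChiralAtZero_subseq_iff (reg : QCDRegularisation Nf) (φ : ℕ → ℕ) (hφ : StrictMono φ) :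
    (subseq reg φ hφ).IsChiralAtZero ↔ ∀ ε > (0 : ℝ), ∃ m : Fin Nf → ℝ, (∀ f, 0 < m f) ∧
      ∃ (R R' : ℕ) (A : QCDLatticeObservable Nf R) (B : QCDLatticeObservable Nf R'), ∀ C : ℝ,
        ∃ᶠ t in atTop, ∃ S : ℕ, reg.L (φ t) ≤ S ∧ ∃ n : ℕ, n ≤ S ∧
          C * Real.exp (-(ε * (reg.a (φ t) * n))) <
            ‖qcdLatticeConnectedCorr (reg.β (φ t)) (2 * S + 1)
              (fun fl => reg.mcrit (φ t) + reg.a (φ t) * m fl / reg.Zm (φ t)) A B n‖ := by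
  unfold QCDRegularisation.IsChiralAtZero QCDScheme.HasLatticeMassGap
  simp only [not_forall, not_exists, Filter.not_eventually, not_le, exists_prop, gt_iff_lt]
  rfl

/-! ## §4 Flanks after the re-type: the flavour restriction `N_f ∈ {2,3}` -/

/-- **NEW after p117723: `QCDOf 0` is FALSE.** At `N_f = 0` the mass tuple is vacuous, so the pin
(`∀ ε > 0`, no lattice gap `ε`) contradicts the gap clause (`∃ Δ > 0`, lattice gap `Δ`) of the same witness —
`HasLatticeMassGap` reads only `β, L, a, m_f(k)`, not `z, shift`. (Before the re-type `QCDOf 0` was the open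
pure-`SU(3)` statement, sibling `Negative.qcdOf_zero_iff` — stale now.) [folklore] -/
theorem not_qcdOf_zero : ¬ QCDOf 0 := by
  rintro ⟨reg, -, hpin, h⟩
  obtain ⟨z, shift, T, -, -, -, -, Δ, hΔ, -, hgap⟩ := h (fun f => f.elim0) (fun f => f.elim0)
  obtain ⟨m, -, hm⟩ := hpin Δ hΔ
  have hm0 : m = fun f => f.elim0 := funext fun f => f.elim0
  subst hm0
  exact hm hgap

/-- At `N_f = 0` the whole per-mass package holds for EVERY regularisation (clauses (i)–(iii) and PQFD quantify
over `Fin 0`; (iv) has ratio `1`: the empty Dirac matrix has determinant `1` and `μ_W` is a probability measure). [folklore] -/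
theorem perMass_zero (reg : QCDRegularisation 0) (m : Fin 0 → ℝ) : PerMass reg m := by
  refine ⟨⟨fun f => f.elim0, ⟨1 / 2, 1, 0, by norm_num, by norm_num, one_pos,
    Eventually.of_forall fun k S _ f => f.elim0⟩, ⟨1 / 2, 1, 0, 0, by norm_num, by norm_num, one_pos,
    Eventually.of_forall fun k S _ f => f.elim0⟩, Eventually.of_forall fun k => ?_⟩,
    ⟨1, one_pos, fun R R' A B hA => ?_⟩⟩
  · have h1 : ∀ U : GaugeConfig 4 (2 * reg.L k + 1) SU3,
        (diracMatrix U fun fl : Fin 0 => reg.mcrit k + reg.a k * m fl / reg.Zm k).det = 1 :=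
      fun U => by rw [det_diracMatrix]; simp
    simp_rw [h1]
    simp
    norm_num
  · obtain ⟨f₀, -⟩ := hA
    exact f₀.elim0

/-- Hence `HypC 0 ↔ ChiralAFReg 0`: a pure-gauge AF sequential scheme WITHOUT a uniform lattice gap at ANY rate. [folklore] -/
theorem hypC_zero_iff : HypC 0 ↔ ChiralAFReg 0 :=
  ⟨fun ⟨reg, hMS, hch, hAS, _⟩ => ⟨reg, hMS, hch, hAS⟩,
    fun ⟨reg, hMS, hch, hAS⟩ => ⟨reg, hMS, hch, hAS, fun m _ => perMass_zero reg m⟩⟩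

/-- **The `N_f = 0` flank of the crux is a lattice Yang–Mills GAP statement, not a counterexample**: extended to
`N_f = 0`, `HypC 0 → QCDOf 0` says (since `QCDOf 0` is false) that EVERY pure-`SU(3)` sequential Wilson scheme
with two-loop asymptotic scaling, `a_k L_k → ∞` (and a leading-log `Z_m` datum) has a volume-uniform lattice mass
gap at SOME positive physical rate — open (Yang–Mills-hard) and believed TRUE. The sibling's flank `QCDOf 0`
(OS data + gap for pure glue, open) has flipped into its lattice-gap shadow. [folklore] -/
theorem at_zero_iff : At 0 ↔ ∀ reg : QCDRegularisation 0, reg.HasMassScaling →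
    (reg.scheme 0 0 0).HasAsymptoticScaling → ∃ ε > (0 : ℝ), (reg.scheme 0 0 0).HasLatticeMassGap ε := by
  constructor
  · intro h reg hMS hAS
    by_contra hne
    push Not at hne
    have hpin : reg.IsChiralAtZero := fun ε hε => ⟨0, fun f => f.elim0, hne ε hε⟩
    exact not_qcdOf_zero (h (hypC_zero_iff.2 ⟨reg, hMS, hpin, hAS⟩))
  · intro h hH
    obtain ⟨reg, hMS, hch, hAS⟩ := hypC_zero_iff.1 hH
    obtain ⟨ε, hε, hgap⟩ := h reg hMS hAS
    obtain ⟨m, -, hm⟩ := hch ε hε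
    have hm0 : m = 0 := funext fun f => f.elim0
    subst hm0
    exact (hm hgap).elim

/-- `N_f = 1` flank (remark made formal): `QCDOf 1` still carries the pin, which for ONE flavour imports a FALSE
physical statement (no Goldstone boson: the `U(1)_A` would-be pion is the anomalous `η′`), and its non-decoupling
clause is vacuous. Neither flank touches `N_f ∈ {2,3}`. [folklore] -/
theorem nondecoupling_vacuous_one (T : OSData (QCDField 1) 4) :
    ∀ f g : Fin 1, f ≠ g → T.IsNontrivial (QCDField.pseudoRe f g) :=
  fun f g hfg => absurd (Subsingleton.elim f g) hfg

/-! ## §5 The shape of the pin: monotonicity, "one gapless point anywhere", and chirality BY BLOW-UP -/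

/-- `HasLatticeMassGap` is antitone in the rate. [folklore] -/
theorem hasLatticeMassGap_anti (sch : QCDScheme Nf) {Δ Δ' : ℝ} (hle : Δ' ≤ Δ)
    (h : sch.HasLatticeMassGap Δ) : sch.HasLatticeMassGap Δ' := by
  intro R R' A B
  obtain ⟨C, hC⟩ := h R R' A B
  refine ⟨max C 0, ?_⟩
  filter_upwards [hC] with k hk S hS n hn
  refine (hk S hS n hn).trans ?_
  have han : 0 ≤ sch.a k * n := mul_nonneg (sch.a_pos k).le (Nat.cast_nonneg n)
  have hexp : Real.exp (-(Δ * (sch.a k * n))) ≤ Real.exp (-(Δ' * (sch.a k * n))) :=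
    Real.exp_le_exp.2 (neg_le_neg (mul_le_mul_of_nonneg_right hle han))
  calc C * Real.exp (-(Δ * (sch.a k * n)))
      ≤ max C 0 * Real.exp (-(Δ * (sch.a k * n))) :=
        mul_le_mul_of_nonneg_right (le_max_left _ _) (Real.exp_pos _).le
    _ ≤ max C 0 * Real.exp (-(Δ' * (sch.a k * n))) := mul_le_mul_of_nonneg_left hexp (le_max_right _ _)

/-- So only SMALL rates matter in the pin: it suffices to witness gaplessness below any fixed `ε₀ > 0`. [folklore] -/
theorem isChiralAtZero_of_small (reg : QCDRegularisation Nf) {ε₀ : ℝ} (hε₀ : 0 < ε₀)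
    (h : ∀ ε, 0 < ε → ε < ε₀ → ∃ m : Fin Nf → ℝ, (∀ f, 0 < m f) ∧ ¬ (reg.scheme m 0 0).HasLatticeMassGap ε) :
    reg.IsChiralAtZero := by
  intro ε hε
  obtain ⟨m, hm, hgap⟩ := h (min ε (ε₀ / 2)) (lt_min hε (by linarith)) (min_lt_of_right_lt (by linarith))
  exact ⟨m, hm, fun hg => hgap (hasLatticeMassGap_anti _ (min_le_left _ _) hg)⟩

/-- **ONE gapless mass point ANYWHERE gives the pin** — the typed clause does not force `m → 0⁺`: a witness whose
honest lattice theory has no uniform gap at a single positive tuple `m⋆` (however heavy, however split) is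
"chiral at zero". In `QCDOf` this is harmless only because the gap clause holds AT `m⋆` (so gaplessness must be
approached, `Δ(m) → 0` as `m → m⋆`, not attained); in the HYPOTHESIS of this crux nothing excludes it. [folklore] -/
theorem isChiralAtZero_of_gaplessPoint (reg : QCDRegularisation Nf)
    (h : ∃ m : Fin Nf → ℝ, (∀ f, 0 < m f) ∧ ∀ ε > (0 : ℝ), ¬ (reg.scheme m 0 0).HasLatticeMassGap ε) :
    reg.IsChiralAtZero := by
  obtain ⟨m, hm, h⟩ := h
  exact fun ε hε => ⟨m, hm, h ε hε⟩

/-- **Blow-up at the mass tuple `m`**: some connected correlator of the honest (signed, `(−1)^F`-twisted) lattice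
theory of `reg` at renormalised masses `m` is UNBOUNDED along the admissible tori — for every constant `C`,
frequently in `k`, some torus `S ≥ L_k` and time `n ≤ S` carry `‖corr‖ > C`. This is a SIGN pathology (the signed
partition function `∫ det D dμ_W`, a supertrace, nearly vanishing on some large torus while the numerator does not),
not Goldstone physics; clause (iv) controls the sign only at the single side `S = L_k`. [folklore] -/
def BlowsUpAt (reg : QCDRegularisation Nf) (m : Fin Nf → ℝ) : Prop :=
  ∃ (R R' : ℕ) (A : QCDLatticeObservable Nf R) (B : QCDLatticeObservable Nf R'), ∀ C : ℝ, ∃ᶠ k in atTop,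
    ∃ S : ℕ, reg.L k ≤ S ∧ ∃ n : ℕ, n ≤ S ∧
      C < ‖qcdLatticeConnectedCorr (reg.β k) (2 * S + 1) (fun fl => reg.mcrit k + reg.a k * m fl / reg.Zm k) A B n‖

/-- A blow-up point has no uniform lattice gap at ANY non-negative rate (for any species renormalisations). [folklore] -/
theorem not_hasLatticeMassGap_of_blowsUpAt {reg : QCDRegularisation Nf} {m : Fin Nf → ℝ} (h : BlowsUpAt reg m)
    {Δ : ℝ} (hΔ : 0 ≤ Δ) (z shift : QCDField Nf → ℕ → ℝ) : ¬ (reg.scheme m z shift).HasLatticeMassGap Δ := by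
  obtain ⟨R, R', A, B, hAB⟩ := h
  intro hgap
  obtain ⟨C, hC⟩ := hgap R R' A B
  have hfr := hAB (max C 0)
  obtain ⟨k, ⟨S, hS, n, hn, hlt⟩, hk⟩ := (hfr.and_eventually hC).exists
  have h1 := hk S hS n hn
  have han : 0 ≤ reg.a k * n := mul_nonneg (reg.a_pos k).le (Nat.cast_nonneg n)
  have hexp : Real.exp (-(Δ * (reg.a k * n))) ≤ 1 :=
    Real.exp_le_one_iff.2 (neg_nonpos.2 (mul_nonneg hΔ han))
  have h2 : C * Real.exp (-(Δ * ((reg.scheme m z shift).a k * n))) ≤ max C 0 := by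
    calc C * Real.exp (-(Δ * ((reg.scheme m z shift).a k * n)))
        ≤ max C 0 * Real.exp (-(Δ * (reg.a k * n))) :=
          mul_le_mul_of_nonneg_right (le_max_left _ _) (Real.exp_pos _).le
      _ ≤ max C 0 * 1 := mul_le_mul_of_nonneg_left hexp (le_max_right _ _)
      _ = max C 0 := mul_one _
  exact absurd (h1.trans h2) (not_le.2 hlt)

/-- **Chirality BY BLOW-UP**: a single blow-up point at positive masses makes `reg` "chiral at zero" — with no light
pion anywhere. So the pin, as typed, certifies "gapless OR sign-singular", and a hypothesis witness may satisfy it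
the cheap way. [folklore] -/
theorem isChiralAtZero_of_blowsUpAt {reg : QCDRegularisation Nf} {m : Fin Nf → ℝ} (hm : ∀ f, 0 < m f)
    (h : BlowsUpAt reg m) : reg.IsChiralAtZero :=
  isChiralAtZero_of_gaplessPoint reg ⟨m, hm, fun _ hε => not_hasLatticeMassGap_of_blowsUpAt h hε.le 0 0⟩

/-- **… and then keep-`reg` is IMPOSSIBLE**: at a blow-up point NO species renormalisation gives the conclusion's
lattice gap clause for the same regularisation. A keep-`reg` (or keep-`reg`-along-`φ`, if the blow-up persists
along `φ`) line must therefore FIRST prove volume-uniform boundedness of all signed connected correlators at every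
`m > 0` on all tori `S ≥ L_k` — the weakest form of the sibling's residual (a) (signed vs phase-quenched beyond the
scheme's own side), which (iv) + PQFD do not supply (`GluonicCompletion.Negative.reweighting_not_bookkeeping`). [folklore] -/
theorem no_sameReg_latticeGap_of_blowsUpAt {reg : QCDRegularisation Nf} {m : Fin Nf → ℝ} (h : BlowsUpAt reg m) :
    ¬ ∃ (z shift : QCDField Nf → ℕ → ℝ), ∃ Δ > (0 : ℝ), (reg.scheme m z shift).HasLatticeMassGap Δ := by
  rintro ⟨z, shift, Δ, hΔ, hgap⟩
  exact not_hasLatticeMassGap_of_blowsUpAt h hΔ.le z shift hgap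

/-- Conversely the conclusion's gap clause forces BOUNDEDNESS: under `HasLatticeMassGap Δ` (`Δ ≥ 0`) every pair of
observables has volume-uniformly bounded connected correlators eventually — the honest functional `qcdTorusExpect`
(a ratio of signed integrals) must be under control on ALL `S ≥ L_k`, not only at `S = L_k` where (iv) lives. [folklore] -/
theorem bounded_of_hasLatticeMassGap (sch : QCDScheme Nf) {Δ : ℝ} (hΔ : 0 ≤ Δ) (h : sch.HasLatticeMassGap Δ)
    {R R' : ℕ} (A : QCDLatticeObservable Nf R) (B : QCDLatticeObservable Nf R') :
    ∃ C : ℝ, ∀ᶠ k in atTop, ∀ S : ℕ, sch.L k ≤ S → ∀ n : ℕ, n ≤ S →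
      ‖qcdLatticeConnectedCorr (sch.β k) (2 * S + 1) (fun fl => sch.mq fl k) A B n‖ ≤ C := by
  obtain ⟨C, hC⟩ := h R R' A B
  refine ⟨max C 0, ?_⟩
  filter_upwards [hC] with k hk S hS n hn
  refine (hk S hS n hn).trans ?_
  have han : 0 ≤ sch.a k * n := mul_nonneg (sch.a_pos k).le (Nat.cast_nonneg n)
  have hexp : Real.exp (-(Δ * (sch.a k * n))) ≤ 1 :=
    Real.exp_le_one_iff.2 (neg_nonpos.2 (mul_nonneg hΔ han))
  calc C * Real.exp (-(Δ * (sch.a k * n)))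
      ≤ max C 0 * Real.exp (-(Δ * (sch.a k * n))) :=
        mul_le_mul_of_nonneg_right (le_max_left _ _) (Real.exp_pos _).le
    _ ≤ max C 0 * 1 := mul_le_mul_of_nonneg_left hexp (le_max_right _ _)
    _ = max C 0 := mul_one _


/-- The lattice gap clause ignores the species renormalisations: the pin (read at `z = shift = 0`) and the
conclusion's `HasLatticeMassGap` (read at the witness's `z, shift`) are the SAME proposition. [folklore] -/
theorem hasLatticeMassGap_scheme_irrel (reg : QCDRegularisation Nf) (m : Fin Nf → ℝ)
    (z shift : QCDField Nf → ℕ → ℝ) (Δ : ℝ) :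
    (reg.scheme m z shift).HasLatticeMassGap Δ ↔ (reg.scheme m 0 0).HasLatticeMassGap Δ := Iff.rfl

/-- So along ONE regularisation the pin and the gap clause of `QCDOf` are jointly satisfiable only if the best gap
rate degenerates: for every `ε > 0` some positive tuple `m` has ALL its admissible rates `Δ(m) < ε`. [folklore] -/
theorem gapRate_lt_of_pin (reg : QCDRegularisation Nf) (hpin : reg.IsChiralAtZero) {ε : ℝ} (hε : 0 < ε) :
    ∃ m : Fin Nf → ℝ, (∀ f, 0 < m f) ∧ ∀ (z shift : QCDField Nf → ℕ → ℝ) (Δ : ℝ),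
      (reg.scheme m z shift).HasLatticeMassGap Δ → Δ < ε := by
  obtain ⟨m, hm, hgap⟩ := hpin ε hε
  refine ⟨m, hm, fun z shift Δ hΔ => ?_⟩
  by_contra hle
  exact hgap (hasLatticeMassGap_anti _ (not_lt.1 hle) ((hasLatticeMassGap_scheme_irrel reg m z shift Δ).1 hΔ))

/-- **Uniform chirality** (the physics the docstring of `IsChiralAtZero` describes: ALL light enough positive
tuples are gapless at rate `ε`) implies the typed pin, which only asks for ONE tuple per rate. The converse fails
as typed (§5: one gapless or blow-up point anywhere suffices), so the hypothesis of this crux is WEAKER than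
"Goldstone along the trajectory" and the conclusion correspondingly easier — consistent, no refutation. [folklore] -/
theorem isChiralAtZero_of_uniform (reg : QCDRegularisation Nf)
    (h : ∀ ε > (0 : ℝ), ∃ δ > (0 : ℝ), ∀ m : Fin Nf → ℝ, (∀ f, 0 < m f ∧ m f < δ) →
      ¬ (reg.scheme m 0 0).HasLatticeMassGap ε) :
    reg.IsChiralAtZero := by
  intro ε hε
  obtain ⟨δ, hδ, hm⟩ := h ε hε
  exact ⟨fun _ => δ / 2, fun _ => by linarith, hm _ fun _ => ⟨by linarith, by linarith⟩⟩


/-- **Inside `QCDOf` the blow-up route is closed**: the conclusion's witness is gapped at EVERY positive tuple, hence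
has no blow-up point at positive masses — there the pin can only be met the Goldstone way (degenerating gap rates,
`gapRate_lt_of_pin`). The asymmetry is entirely on the HYPOTHESIS side of this crux: `HypC` admits blow-up-chiral
witnesses, `QCDOf` does not; a completion must either exclude them (prove signed boundedness from (i)–(iv)+PQFD —
not available beyond `S = L_k`) or never use the hypothesis' pin at a blow-up tuple. [folklore] -/
theorem qcdOf_witness_noBlowup {reg : QCDRegularisation Nf}
    (hgap : ∀ m : Fin Nf → ℝ, (∀ f, 0 < m f) →
      ∃ (z shift : QCDField Nf → ℕ → ℝ), ∃ Δ > (0 : ℝ), (reg.scheme m z shift).HasLatticeMassGap Δ)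
    {m : Fin Nf → ℝ} (hm : ∀ f, 0 < m f) : ¬ BlowsUpAt reg m :=
  fun hb => no_sameReg_latticeGap_of_blowsUpAt hb (hgap m hm)

/-- The gap clause of `QCDOf`, extracted: its witness is gapped at every positive tuple (so `qcdOf_witness_noBlowup`
applies to it). [folklore] -/
theorem qcdOf_witness_gapped (h : QCDOf Nf) : ∃ reg : QCDRegularisation Nf, reg.IsChiralAtZero ∧
    ∀ m : Fin Nf → ℝ, (∀ f, 0 < m f) →
      ∃ (z shift : QCDField Nf → ℕ → ℝ), ∃ Δ > (0 : ℝ), (reg.scheme m z shift).HasLatticeMassGap Δ := by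
  obtain ⟨reg, -, hch, hall⟩ := h
  refine ⟨reg, hch, fun m hm => ?_⟩
  obtain ⟨z, shift, T, -, -, -, -, Δ, hΔ, -, hL⟩ := hall m hm
  exact ⟨z, shift, Δ, hΔ, hL⟩

/-! ## §6 The hypothesis MINUS the pin is invariant under up-shifts of the critical mass — so the pin is the
only datum of `HypC` that locates the chiral point, and "package ⇒ chiral" cannot be a `∀ reg` item -/

/-- The bare-mass function of the shifted regularisation at `m` is that of `reg` at `M₀ + m`. [folklore] -/
theorem bareMass_mcritShift (reg : QCDRegularisation Nf) (M₀ : ℝ) (m : Fin Nf → ℝ) (k : ℕ) :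
    (fun fl : Fin Nf => reg.mcrit k + reg.a k * M₀ / reg.Zm k + reg.a k * m fl / reg.Zm k) =
      fun fl => reg.mcrit k + reg.a k * (M₀ + m fl) / reg.Zm k := by
  funext fl
  ring

/-- Clause (i) transports along the up-shift. [folklore] -/
theorem clauseI_mcritShift_iff (reg : QCDRegularisation Nf) (M₀ : ℝ) (m : Fin Nf → ℝ) :
    ClauseI (mcritShift reg M₀) m ↔ ClauseI reg (fun f => M₀ + m f) := by
  have h : ∀ (k : ℕ) (fl : Fin Nf), reg.mcrit k + reg.a k * M₀ / reg.Zm k + reg.a k * m fl / reg.Zm k =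
      reg.mcrit k + reg.a k * (M₀ + m fl) / reg.Zm k := by
    intros; ring
  simp only [ClauseI, mcritShift, h]

/-- Clause (ii) transports along the up-shift. [folklore] -/
theorem clauseII_mcritShift_iff (reg : QCDRegularisation Nf) (M₀ : ℝ) (m : Fin Nf → ℝ) :
    ClauseII (mcritShift reg M₀) m ↔ ClauseII reg (fun f => M₀ + m f) := by
  simp only [ClauseII, mcritShift, bareMass_mcritShift]

/-- Clause (iii) transports along the up-shift. [folklore] -/
theorem clauseIII_mcritShift_iff (reg : QCDRegularisation Nf) (M₀ : ℝ) (m : Fin Nf → ℝ) :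
    ClauseIII (mcritShift reg M₀) m ↔ ClauseIII reg (fun f => M₀ + m f) := by
  simp only [ClauseIII, mcritShift, bareMass_mcritShift]

/-- Clause (iv) transports along the up-shift. [folklore] -/
theorem clauseIV_mcritShift_iff (reg : QCDRegularisation Nf) (M₀ : ℝ) (m : Fin Nf → ℝ) :
    ClauseIV (mcritShift reg M₀) m ↔ ClauseIV reg (fun f => M₀ + m f) := by
  simp only [ClauseIV, mcritShift, bareMass_mcritShift]
  exact Iff.rfl

/-- PQFD transports along the up-shift. [folklore] -/
theorem pqfd_mcritShift_iff (reg : QCDRegularisation Nf) (M₀ : ℝ) (m : Fin Nf → ℝ) :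
    PQFD (mcritShift reg M₀) m ↔ PQFD reg (fun f => M₀ + m f) := by
  simp only [PQFD, mcritShift, bareMass_mcritShift]

/-- **The per-mass package of the shifted regularisation at `m` is the package of `reg` at `M₀ + m`.** [folklore] -/
theorem perMass_mcritShift_iff (reg : QCDRegularisation Nf) (M₀ : ℝ) (m : Fin Nf → ℝ) :
    PerMass (mcritShift reg M₀) m ↔ PerMass reg (fun f => M₀ + m f) := by
  simp only [PerMass, clauseI_mcritShift_iff, clauseII_mcritShift_iff, clauseIII_mcritShift_iff,
    clauseIV_mcritShift_iff, pqfd_mcritShift_iff]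

/-- **`HypC` minus the pin (= the sibling's hypothesis body) is invariant under every up-shift `M₀ ≥ 0`.**
Nothing in the scaling side conditions or in (i)–(iv)/PQFD distinguishes a regularisation from its up-shifted
copies; only the pin does (`isChiralAtZero_mcritShift_iff`). [folklore] -/
theorem hypGBody_mcritShift (reg : QCDRegularisation Nf) {M₀ : ℝ} (hM₀ : 0 ≤ M₀)
    (hMS : reg.HasMassScaling) (hAS : (reg.scheme 0 0 0).HasAsymptoticScaling)
    (hper : ∀ m : Fin Nf → ℝ, (∀ f, 0 < m f) → PerMass reg m) :
    (mcritShift reg M₀).HasMassScaling ∧ ((mcritShift reg M₀).scheme 0 0 0).HasAsymptoticScaling ∧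
      ∀ m : Fin Nf → ℝ, (∀ f, 0 < m f) → PerMass (mcritShift reg M₀) m :=
  ⟨hMS, hAS, fun m hm => (perMass_mcritShift_iff reg M₀ m).2 (hper _ fun f => by linarith [hm f])⟩

/-- Hence, given ONE hypothesis witness, its up-shift by `M₀ ≥ 0` is again a hypothesis witness iff the original is
chiral above `M₀`: the family of `HypC`-witnesses generated by up-shifts is truncated exactly by chirality. [folklore] -/
theorem hypBody_mcritShift_iff (reg : QCDRegularisation Nf) (hB : HypBody reg) {M₀ : ℝ} (hM₀ : 0 ≤ M₀) :
    HypBody (mcritShift reg M₀) ↔ ChiralAbove reg M₀ := by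
  obtain ⟨hMS, -, hAS, hper⟩ := hB
  obtain ⟨hMS', hAS', hper'⟩ := hypGBody_mcritShift reg hM₀ hMS hAS hper
  constructor
  · rintro ⟨-, hch, -, -⟩
    exact (isChiralAtZero_mcritShift_iff reg M₀).1 hch
  · intro hch
    exact ⟨hMS', (isChiralAtZero_mcritShift_iff reg M₀).2 hch, hAS', hper'⟩

variable (Nf) in
/-- "The package forces chirality" as a `∀ reg` statement (the tempting separate item the route text warns
against: `∀ reg, HasMassScaling → HasAsymptoticScaling → (∀ m > 0, package) → IsChiralAtZero`). [folklore] -/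
def PackageForcesChirality : Prop :=
  ∀ reg : QCDRegularisation Nf, reg.HasMassScaling → (reg.scheme 0 0 0).HasAsymptoticScaling →
    (∀ m : Fin Nf → ℝ, (∀ f, 0 < m f) → PerMass reg m) → reg.IsChiralAtZero

/-- **The route text's warning, certified**: `PackageForcesChirality` is EQUIVALENT to "every package-carrying
regularisation is chiral above EVERY offset `M₀ ≥ 0`" — gapless (or blow-up) points at arbitrarily HEAVY masses,
i.e. no package-carrying regularisation has a uniform lattice gap above any threshold. For an honest trajectory
(uniformly gapped once all quarks are heavier than some `M₀`) this is absurd; so chirality must ride INSIDE the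
`∃ reg` of the hypothesis, as filed, and crux #5's planned split `MobilityEdgeIsChiralPoint` must quantify over
package-MINIMAL regularisations, not over all of them. [folklore] -/
theorem packageForcesChirality_iff :
    PackageForcesChirality Nf ↔ ∀ reg : QCDRegularisation Nf, reg.HasMassScaling →
      (reg.scheme 0 0 0).HasAsymptoticScaling → (∀ m : Fin Nf → ℝ, (∀ f, 0 < m f) → PerMass reg m) →
        ∀ M₀ : ℝ, 0 ≤ M₀ → ChiralAbove reg M₀ := by
  constructor
  · intro h reg hMS hAS hper M₀ hM₀
    obtain ⟨hMS', hAS', hper'⟩ := hypGBody_mcritShift reg hM₀ hMS hAS hper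
    exact (isChiralAtZero_mcritShift_iff reg M₀).1 (h _ hMS' hAS' hper')
  · intro h reg hMS hAS hper
    exact (chiralAbove_zero_iff reg).1 (h reg hMS hAS hper 0 le_rfl)

/-- … in particular it is refuted by any single package-carrying regularisation with a uniform lattice gap above
some threshold (the expected shape of every honest witness). [folklore] -/
theorem not_packageForcesChirality_of (reg : QCDRegularisation Nf) (hMS : reg.HasMassScaling)
    (hAS : (reg.scheme 0 0 0).HasAsymptoticScaling) (hper : ∀ m : Fin Nf → ℝ, (∀ f, 0 < m f) → PerMass reg m)
    {M₀ : ℝ} (hM₀ : 0 ≤ M₀)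
    (hgap : ∃ ε > (0 : ℝ), ∀ m : Fin Nf → ℝ, (∀ f, M₀ < m f) → (reg.scheme m 0 0).HasLatticeMassGap ε) :
    ¬ PackageForcesChirality Nf := fun h =>
  not_chiralAbove_of_uniformGap reg M₀ hgap ((packageForcesChirality_iff.1 h) reg hMS hAS hper M₀ hM₀)

end Summit.QuantumFields.QCD.Cruxes.ChiralGluonicCompletion.Disproof

end
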